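import Literature.Probability.LatticeModels.LebowitzInequality
import HarnessLib

/-!
# Lebowitz' inequality for arbitrary products, `⟨t^A q^B⟩ ≤ ⟨t^A⟩⟨q^B⟩` (Glimm–Jaffe, Cor. 4.3.2)

Topic `Probability/LatticeModels`; first of three PROOF files (this one, `LebowitzPairTruncation`,
`LebowitzPairTruncationIsing`) formalising J. Glimm, A. Jaffe, *Quantum Physics — A Functional
Integral Point of View*, 2nd ed. (Springer 1987), §4.3, Cor. 4.3.2 (third inequality) and Cor. 4.3.3
(the pair-truncation tree bound) [GlimmJaffe1987] for the spin-`½` systems `ν_{Λ;K}` of the tree's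
`GKSInequalities` (nonnegative couplings `Kᵢ` supported on at most two sites — the finite-volume
ferromagnetic Ising model with pair interactions and fields, Lebowitz 1974 [Lebowitz1974]), on top of
the fourfold-replica machinery of `LebowitzInequality` (which proves the class positivity of
Thm. 4.3.1, `sum_repClass_mul_gksWeight4_nonneg`, and states only the degree-`(2,2)` case
`lebowitz_pair` of Cor. 4.3.2). No definition, no named fact; everything is PROVED.

* `lebowitz_prod` — Cor. 4.3.2, third inequality, for arbitrary finite sets `A` (the `t`-factors)
  and `B` (the `q`-factors): `Z² ∑∑ T^A Q^B ww ≤ (∑∑ T^A ww)(∑∑ Q^B ww)` in the unnormalised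
  duplicated variables `T = σ + σ'`, `Q = σ - σ'`. Printed proof: the difference is
  `∑_c T^A(ξ,χ)[Q^B(ξ',χ') - Q^B(ξ,χ)] w⁴`, and `T^A = 2^{-|A|}(A+B)^A`,
  `Q'^B - Q^B = 2^{-|B|}[(C+D)^B - (C-D)^B] = 2^{1-|B|} ∑_{|T| odd} D^T C^{B∖T}` are nonnegative
  combinations of monomials in the rotated variables (Lemma 4.1.2), each of nonnegative
  replicated expectation (Thm. 4.3.1).
* `prod_tVar2_mul_prod_qVar2_eq_sum`, `gksSum2_prod_tVar2_mul_prod_qVar2`, `gksSum2_prod_tVar2`,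
  `gksSum2_prod_qVar2` — the expansion of `T^A Q^B` in the original spins (first display of the
  proof of Cor. 4.3.3): `∑∑ T^A Q^B ww = ∑_{A₁ ⊆ A, B₁ ⊆ B} (-1)^{|B∖B₁|} Z⟨σ_{A₁∆B₁}⟩ Z⟨σ_{A₂∆B₂}⟩`.
* `gksSum_spinProduct_eq_zero_of_odd` — the spin-flip symmetry `⟨σ_X⟩ = 0`, `|X|` odd, when every
  term with nonzero coupling has even support (`hᵢ ≡ 0`).

## References

* [GlimmJaffe1987] J. Glimm, A. Jaffe, *Quantum Physics*, 2nd ed., Springer 1987, §4.3,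
  Thm. 4.3.1, Cor. 4.3.2, Cor. 4.3.3 (pp. 59–62; read from the held copy).
* [Lebowitz1974] J. L. Lebowitz, *GHS and other inequalities*, Comm. Math. Phys. 35 (1974) 87–92.
-/

noncomputable section

open Finset
open scoped symmDiff

namespace Literature.Probability.LatticeModels

section Lebowitz

variable {Λ : Type*} [Fintype Λ] [DecidableEq Λ] {ι : Type*}
variable (s : Finset ι) (K : ι → ℝ) (C : ι → Finset Λ)

/-! ### Corollary 4.3.2 (third inequality) for arbitrary sets: `⟨t^A q^B⟩ ≤ ⟨t^A⟩⟨q^B⟩` -/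

/-- **Lebowitz' inequality for products** (Glimm–Jaffe 1987, Cor. 4.3.2, third inequality, general
`A`, `B`; Lebowitz 1974): in the duplicated system `T = σ + σ'`, `Q = σ - σ'`, for `Kᵢ ≥ 0` on
supports of at most two sites, `Z² ∑∑ T^A Q^B ww ≤ (∑∑ T^A ww)(∑∑ Q^B ww)` where
`T^A = ∏_{z ∈ A} T_z`, `Q^B = ∏_{x ∈ B} Q_x`. Proof as printed: the difference is
`∑_c T^A(ξ,χ)[Q^B(ξ',χ') - Q^B(ξ,χ)] w⁴` with `T^A = 2^{-|A|}(A+B)^A = 2^{-|A|} ∑_S B^S A^{A∖S}` and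
`Q'^B - Q^B = 2^{-|B|}[(C+D)^B - (C-D)^B] = 2^{-|B|} ∑_T (1 - (-1)^{|T|}) D^T C^{B∖T}`, a
nonnegative combination of monomials in the rotated variables, each of nonnegative replicated
expectation (`sum_repClass_mul_gksWeight4_nonneg`, Thm. 4.3.1). [cite: GlimmJaffe1987, Cor. 4.3.2 (third inequality)] -/
theorem lebowitz_prod (hK : ∀ i ∈ s, 0 ≤ K i) (hC : ∀ i ∈ s, (C i).card ≤ 2) (A B : Finset Λ) :
    gksSum2 s K C (fun ξ χ => (∏ z ∈ A, tVar2 z ξ χ) * ∏ x ∈ B, qVar2 x ξ χ) *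
        gksSum2 s K C (fun _ _ => 1) ≤
      gksSum2 s K C (fun ξ χ => ∏ z ∈ A, tVar2 z ξ χ) *
        gksSum2 s K C (fun ξ χ => ∏ x ∈ B, qVar2 x ξ χ) := by
  rw [← sub_nonneg, ← sum_cfg4_mul_mul_gksWeight4, ← sum_cfg4_mul_mul_gksWeight4,
    ← Finset.sum_sub_distrib]
  have hpos := sum_repClass_mul_gksWeight4_nonneg s K C hK hC
  -- the monomials of the expansion
  set mono : Finset Λ → Finset Λ → Cfg4 Λ → ℝ := fun S T c =>
    ((∏ z ∈ S, repB z c) * ∏ z ∈ A \ S, repA z c) * ((∏ x ∈ T, repD x c) * ∏ x ∈ B \ T, repC x c)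
    with hmono
  have hmono_mem : ∀ S T, mono S T ∈ (repClass : Set (Cfg4 Λ → ℝ)) := by
    intro S T
    exact mul_mem_repClass
      (mul_mem_repClass (prod_mem_repClass S _ fun z _ => repB_mem_repClass z)
        (prod_mem_repClass (A \ S) _ fun z _ => repA_mem_repClass z))
      (mul_mem_repClass (prod_mem_repClass T _ fun x _ => repD_mem_repClass x)
        (prod_mem_repClass (B \ T) _ fun x _ => repC_mem_repClass x))
  -- expansions of `T^A(ξ,χ)`, `Q^B(ξ',χ')`, `Q^B(ξ,χ)` in the rotated variables
  have htA : ∀ c : Cfg4 Λ, ∏ z ∈ A, tVar2 z c.1 c.2.1 =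
      (1 / 2) ^ A.card * ∑ S ∈ A.powerset, (∏ z ∈ S, repB z c) * ∏ z ∈ A \ S, repA z c := by
    intro c
    calc ∏ z ∈ A, tVar2 z c.1 c.2.1 = ∏ z ∈ A, ((1 / 2 : ℝ) * (repB z c + repA z c)) :=
          Finset.prod_congr rfl fun z _ => by rw [tVar2_eq]; ring
      _ = (1 / 2) ^ A.card * ∏ z ∈ A, (repB z c + repA z c) := by
          rw [Finset.prod_mul_distrib, Finset.prod_const]
      _ = _ := by rw [Finset.prod_add]
  have hqB' : ∀ c : Cfg4 Λ, ∏ x ∈ B, qVar2 x c.2.2.1 c.2.2.2 =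
      (1 / 2) ^ B.card * ∑ T ∈ B.powerset, (∏ x ∈ T, repD x c) * ∏ x ∈ B \ T, repC x c := by
    intro c
    calc ∏ x ∈ B, qVar2 x c.2.2.1 c.2.2.2 = ∏ x ∈ B, ((1 / 2 : ℝ) * (repD x c + repC x c)) :=
          Finset.prod_congr rfl fun x _ => by rw [qVar2_eq']; ring
      _ = (1 / 2) ^ B.card * ∏ x ∈ B, (repD x c + repC x c) := by
          rw [Finset.prod_mul_distrib, Finset.prod_const]
      _ = _ := by rw [Finset.prod_add]
  have hqB : ∀ c : Cfg4 Λ, ∏ x ∈ B, qVar2 x c.1 c.2.1 =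
      (1 / 2) ^ B.card * ∑ T ∈ B.powerset,
        (-1) ^ T.card * ((∏ x ∈ T, repD x c) * ∏ x ∈ B \ T, repC x c) := by
    intro c
    calc ∏ x ∈ B, qVar2 x c.1 c.2.1 = ∏ x ∈ B, ((1 / 2 : ℝ) * (-repD x c + repC x c)) :=
          Finset.prod_congr rfl fun x _ => by rw [qVar2_eq]; ring
      _ = (1 / 2) ^ B.card * ∏ x ∈ B, (-repD x c + repC x c) := by
          rw [Finset.prod_mul_distrib, Finset.prod_const]
      _ = (1 / 2) ^ B.card * ∑ T ∈ B.powerset, (∏ x ∈ T, -repD x c) * ∏ x ∈ B \ T, repC x c := by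
          rw [Finset.prod_add]
      _ = _ := by
          congr 1
          refine Finset.sum_congr rfl fun T _ => ?_
          rw [Finset.prod_neg]
          ring
  -- the integrand as a nonnegative combination of monomials
  have key : ∀ c : Cfg4 Λ,
      (∏ z ∈ A, tVar2 z c.1 c.2.1) * (∏ x ∈ B, qVar2 x c.2.2.1 c.2.2.2) * gksWeight4 s K C c -
        (∏ z ∈ A, tVar2 z c.1 c.2.1) * (∏ x ∈ B, qVar2 x c.1 c.2.1) * 1 * gksWeight4 s K C c =
      (1 / 2) ^ A.card * (1 / 2) ^ B.card *
        ∑ S ∈ A.powerset, ∑ T ∈ B.powerset, (1 - (-1) ^ T.card) * (mono S T c * gksWeight4 s K C c) := by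
    intro c
    rw [htA c, hqB' c, hqB c]
    have hR : (∑ T ∈ B.powerset, (∏ x ∈ T, repD x c) * ∏ x ∈ B \ T, repC x c) -
        ∑ T ∈ B.powerset, (-1) ^ T.card * ((∏ x ∈ T, repD x c) * ∏ x ∈ B \ T, repC x c) =
        ∑ T ∈ B.powerset, (1 - (-1) ^ T.card) * ((∏ x ∈ T, repD x c) * ∏ x ∈ B \ T, repC x c) := by
      rw [← Finset.sum_sub_distrib]
      exact Finset.sum_congr rfl fun T _ => by ring
    calc _ = (1 / 2) ^ A.card * (1 / 2) ^ B.card *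
          ((∑ S ∈ A.powerset, (∏ z ∈ S, repB z c) * ∏ z ∈ A \ S, repA z c) *
            ((∑ T ∈ B.powerset, (∏ x ∈ T, repD x c) * ∏ x ∈ B \ T, repC x c) -
              ∑ T ∈ B.powerset, (-1) ^ T.card * ((∏ x ∈ T, repD x c) * ∏ x ∈ B \ T, repC x c))) *
          gksWeight4 s K C c := by ring
      _ = (1 / 2) ^ A.card * (1 / 2) ^ B.card *
          ((∑ S ∈ A.powerset, (∏ z ∈ S, repB z c) * ∏ z ∈ A \ S, repA z c) *
            ∑ T ∈ B.powerset, (1 - (-1) ^ T.card) * ((∏ x ∈ T, repD x c) * ∏ x ∈ B \ T, repC x c)) *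
          gksWeight4 s K C c := by rw [hR]
      _ = _ := by
          rw [Finset.sum_mul_sum, mul_assoc, Finset.sum_mul]
          congr 1
          refine Finset.sum_congr rfl fun S _ => ?_
          rw [Finset.sum_mul]
          refine Finset.sum_congr rfl fun T _ => ?_
          simp only [hmono]
          ring
  simp_rw [key]
  rw [← Finset.mul_sum]
  refine mul_nonneg (by positivity) ?_
  rw [Finset.sum_comm]
  refine Finset.sum_nonneg fun S _ => ?_
  rw [Finset.sum_comm]
  refine Finset.sum_nonneg fun T _ => ?_
  rw [← Finset.mul_sum]
  refine mul_nonneg ?_ (hpos (mono S T) (hmono_mem S T))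
  rcases neg_one_pow_eq_or ℝ T.card with h | h <;> rw [h] <;> norm_num


/-! ### Expansion of the duplicated products in correlations -/

/-- Bilinear expansion of the duplicated sum: if `F(ξ,χ) = ∑_p c_p f_p(ξ) g_p(χ)` pointwise then
`∑∑ F ww = ∑_p c_p (Z⟨f_p⟩)(Z⟨g_p⟩)`. [folklore] -/
theorem gksSum2_eq_sum_of_pointwise {κ : Type*} (F : SpinConfig Λ → SpinConfig Λ → ℝ)
    (P : Finset κ) (cf : κ → ℝ) (f g : κ → SpinConfig Λ → ℝ)
    (hF : ∀ ξ χ, F ξ χ = ∑ p ∈ P, cf p * (f p ξ * g p χ)) :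
    gksSum2 s K C F = ∑ p ∈ P, cf p * (gksSum s K C (f p) * gksSum s K C (g p)) := by
  unfold gksSum2 gksSum
  have h1 : ∀ ξ χ : SpinConfig Λ,
      F ξ χ * (gksWeight s K C ξ * gksWeight s K C χ) =
        ∑ p ∈ P, cf p * (f p ξ * g p χ) * (gksWeight s K C ξ * gksWeight s K C χ) :=
    fun ξ χ => by rw [hF]; exact Finset.sum_mul _ _ _
  have h2 : ∀ ξ : SpinConfig Λ,
      ∑ χ : SpinConfig Λ, ∑ p ∈ P, cf p * (f p ξ * g p χ) * (gksWeight s K C ξ * gksWeight s K C χ) =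
        ∑ p ∈ P, ∑ χ : SpinConfig Λ, cf p * (f p ξ * g p χ) * (gksWeight s K C ξ * gksWeight s K C χ) :=
    fun ξ => Finset.sum_comm
  simp_rw [h1, h2]
  rw [Finset.sum_comm]
  refine Finset.sum_congr rfl fun p _ => ?_
  rw [Finset.sum_mul_sum, Finset.mul_sum]
  refine Finset.sum_congr rfl fun ξ _ => ?_
  rw [Finset.mul_sum]
  exact Finset.sum_congr rfl fun χ _ => by ring

omit [Fintype Λ] in
/-- Pointwise expansion `T^A Q^B = ∑_{A₁ ⊆ A, B₁ ⊆ B} (-1)^{|B∖B₁|} σ_{A₁∆B₁}(ξ) σ_{(A∖A₁)∆(B∖B₁)}(χ)`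
(`T = ξ + χ`, `Q = ξ - χ`; Glimm–Jaffe 1987, proof of Cor. 4.3.3, first display).
[cite: GlimmJaffe1987, proof of Cor. 4.3.3] -/
theorem prod_tVar2_mul_prod_qVar2_eq_sum (A B : Finset Λ) (ξ χ : SpinConfig Λ) :
    (∏ z ∈ A, tVar2 z ξ χ) * ∏ x ∈ B, qVar2 x ξ χ =
      ∑ p ∈ A.powerset ×ˢ B.powerset, (-1) ^ (B \ p.2).card *
        (spinProduct (p.1 ∆ p.2) ξ * spinProduct ((A \ p.1) ∆ (B \ p.2)) χ) := by
  have hT : ∏ z ∈ A, tVar2 z ξ χ =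
      ∑ A₁ ∈ A.powerset, spinProduct A₁ ξ * spinProduct (A \ A₁) χ := by
    unfold tVar2
    rw [Finset.prod_add]
    simp only [spinProduct]
  have hQ : ∏ x ∈ B, qVar2 x ξ χ =
      ∑ B₁ ∈ B.powerset, (-1) ^ (B \ B₁).card * (spinProduct B₁ ξ * spinProduct (B \ B₁) χ) := by
    unfold qVar2
    simp_rw [sub_eq_add_neg]
    rw [Finset.prod_add]
    refine Finset.sum_congr rfl fun B₁ _ => ?_
    rw [Finset.prod_neg]
    simp only [spinProduct]
    ring
  rw [hT, hQ, Finset.sum_mul_sum, Finset.sum_product]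
  refine Finset.sum_congr rfl fun A₁ _ => Finset.sum_congr rfl fun B₁ _ => ?_
  rw [← spinProduct_mul_eq_spinProduct_symmDiff, ← spinProduct_mul_eq_spinProduct_symmDiff]
  ring

/-- `∑∑ T^A Q^B ww = ∑_{A₁ ⊆ A, B₁ ⊆ B} (-1)^{|B∖B₁|} (Z⟨σ_{A₁∆B₁}⟩)(Z⟨σ_{(A∖A₁)∆(B∖B₁)}⟩)`: expand
`T^A = ∏(ξ + χ)`, `Q^B = ∏(ξ - χ)` (Glimm–Jaffe 1987, proof of Cor. 4.3.3, first display, in the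
unnormalised variables `T = √2 t`, `Q = √2 q`). [cite: GlimmJaffe1987, proof of Cor. 4.3.3] -/
theorem gksSum2_prod_tVar2_mul_prod_qVar2 (A B : Finset Λ) :
    gksSum2 s K C (fun ξ χ => (∏ z ∈ A, tVar2 z ξ χ) * ∏ x ∈ B, qVar2 x ξ χ) =
      ∑ p ∈ A.powerset ×ˢ B.powerset, (-1) ^ (B \ p.2).card *
        (gksSum s K C (spinProduct (p.1 ∆ p.2)) *
          gksSum s K C (spinProduct ((A \ p.1) ∆ (B \ p.2)))) :=
  gksSum2_eq_sum_of_pointwise s K C _ (A.powerset ×ˢ B.powerset) (fun p => (-1 : ℝ) ^ (B \ p.2).card)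
    (fun p => spinProduct (p.1 ∆ p.2)) (fun p => spinProduct ((A \ p.1) ∆ (B \ p.2)))
    (fun ξ χ => prod_tVar2_mul_prod_qVar2_eq_sum A B ξ χ)

/-- `∑∑ T^A ww = ∑_{A₁ ⊆ A} (Z⟨σ_{A₁}⟩)(Z⟨σ_{A∖A₁}⟩)`. [cite: GlimmJaffe1987, proof of Cor. 4.3.3] -/
theorem gksSum2_prod_tVar2 (A : Finset Λ) :
    gksSum2 s K C (fun ξ χ => ∏ z ∈ A, tVar2 z ξ χ) =
      ∑ A₁ ∈ A.powerset, (1 : ℝ) * (gksSum s K C (spinProduct A₁) * gksSum s K C (spinProduct (A \ A₁))) :=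
  gksSum2_eq_sum_of_pointwise s K C _ A.powerset (fun _ => (1 : ℝ)) (fun A₁ => spinProduct A₁)
    (fun A₁ => spinProduct (A \ A₁)) (fun ξ χ => by
      unfold tVar2
      rw [Finset.prod_add]
      simp only [one_mul, spinProduct])

/-- `∑∑ Q^B ww = ∑_{B₁ ⊆ B} (-1)^{|B∖B₁|} (Z⟨σ_{B₁}⟩)(Z⟨σ_{B∖B₁}⟩)`. [cite: GlimmJaffe1987, proof of Cor. 4.3.3] -/
theorem gksSum2_prod_qVar2 (B : Finset Λ) :
    gksSum2 s K C (fun ξ χ => ∏ x ∈ B, qVar2 x ξ χ) =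
      ∑ B₁ ∈ B.powerset, (-1) ^ (B \ B₁).card *
        (gksSum s K C (spinProduct B₁) * gksSum s K C (spinProduct (B \ B₁))) :=
  gksSum2_eq_sum_of_pointwise s K C _ B.powerset (fun B₁ => (-1 : ℝ) ^ (B \ B₁).card)
    (fun B₁ => spinProduct B₁) (fun B₁ => spinProduct (B \ B₁)) (fun ξ χ => by
      unfold qVar2
      simp_rw [sub_eq_add_neg]
      rw [Finset.prod_add]
      refine Finset.sum_congr rfl fun B₁ _ => ?_
      rw [Finset.prod_neg]
      simp only [spinProduct]
      ring)

/-! ### Vanishing of odd correlations under the global spin flip -/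

/-- If every interaction term with nonzero coupling has even support (no field), then
`Z⟨σ_X⟩ = 0` for `|X|` odd (spin-flip symmetry, Friedli–Velenik 2017, §3.7.1, eq. (3.33)). [folklore] -/
theorem gksSum_spinProduct_eq_zero_of_odd (heven : ∀ i ∈ s, K i = 0 ∨ Even (C i).card)
    {X : Finset Λ} (hX : Odd X.card) : gksSum s K C (spinProduct X) = 0 := by
  have hw : ∀ σ, gksWeight s K C (flipOn Finset.univ σ) = gksWeight s K C σ := by
    intro σ
    simp only [gksWeight, gksHamiltonian]
    congr 1
    refine Finset.sum_congr rfl fun i hi => ?_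
    rw [spinProduct_flipOn, Finset.inter_univ]
    rcases heven i hi with h0 | hev
    · simp [h0]
    · rw [hev.neg_one_pow, one_mul]
  have hodd : ∀ σ, spinProduct X (flipOn Finset.univ σ) = -spinProduct X σ := by
    intro σ
    rw [spinProduct_flipOn, Finset.inter_univ, hX.neg_one_pow]
    ring
  unfold gksSum
  have h : ∑ σ, spinProduct X σ * gksWeight s K C σ =
      ∑ σ, spinProduct X (flipOn Finset.univ σ) * gksWeight s K C (flipOn Finset.univ σ) :=
    (Fintype.sum_bijective _ (flipOn_involutive Finset.univ).bijective _ _ fun _ => rfl).symm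
  have h2 : ∑ σ, spinProduct X (flipOn Finset.univ σ) * gksWeight s K C (flipOn Finset.univ σ) =
      -∑ σ, spinProduct X σ * gksWeight s K C σ := by
    rw [← Finset.sum_neg_distrib]
    exact Finset.sum_congr rfl fun σ _ => by rw [hodd, hw]; ring
  linarith

end Lebowitz

end Literature.Probability.LatticeModels

end
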